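import Summits.Ventures.YMGap.RobustBall.RobustStarWindowZdW
import Summits.Ventures.YMGap.RobustBall.RobustStarDoorZdVariance
import HarnessLib

/-!
# Venture YMGap, track ROBUST-BALL (Y2) — crux Y2-X2-WZd, step 5: THE ROBUST VERTEX-STAR DOOR ON THE TIER-2
# (DIAMETER-WEIGHTED, INFINITE-RANGE) `ℤ^d` BALL — the mass gap, uniformly on `MemBallZdW κ ε₀ ε₁`, past the
# single-link threshold

HONEST FRAMING. WHAT THIS IS: a venture file (cell `pub-ymgap`, track Y2 ROBUST-BALL, seat ds-2). For every member
`W` of the gauge-invariant diameter-weighted `ℤ^d` ball `MemBallZdW κ ε₀ ε₁` (`MassGapOnBallZdW.lean`; no range, no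
support list) the weighted star window bound `StarWindowBoundZdW` of the arbitrary-range `ℤ^d` star door
(`StarDoorZdW.lean`) holds for rb-p1's summable specification `perturbedYMS (fundamentalRep (Fin N)) β W`
(`starWindowBoundZdW_of_memBallZdW`). MECHANISM (per vertex `s`, box radius `D`): the NEAR part of the member is
its truncation `truncZd D s W`, a member of the tier-1 ball `MemBallZdG ε₀ ε₁ (2D)`, whose star kernels carry the
robust star array of crux Y2-X2-Zd with locality radius `2D+2` (`starWindowBoundZdR_of_memBallZdG`, chart transfer
from the torus door, used as a black box) — made GLOBAL by `window_contraction_global_of_sitewise` and WEIGHTED at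
the price `e^{t(2D+3)}`; the FAR part (sets meeting the star and leaving the box, diameter `≥ D`, loads
`≤ e^{−κD}`) enters as a tilt of the near kernel (`perturbedYMS_eq_tilted_truncZd`) and is paid by the tilt
comparison (`tilt_comparison`, far-energy bounds of `StarFarEnergyZd` / `StarFarLoadsZd`). With the closing
inequality `hclose` (the near received sum inflated by `e^{2τ̄} e^{t(2D+3)}` plus far terms `≤ ρ' < 1`, which the row
files discharge numerically for a large `D` and a small rate `t`) this gives `MassGapOnBallZdW d N β κ ε₀ ε₁`
(`massGapOnBallZdW_of_robustStar`): the unique DLR state and Shen–Zhu–Zhu clustering for EVERY member of the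
tier-2 `ℤ^d` ball, directly in infinite volume. WHAT THIS IS NOT: no number (rows are the next file); the rate
`t ~ 1/D` and the radii are door artefacts; strong-coupling LATTICE statement — nothing about the continuum or
the Millennium problem.

## References
* R. L. Dobrushin, S. B. Shlosman (1985), Thm. 1; H. Föllmer, LNM 1362 (1988) Ch. I (2.13)–(2.14), (2.20);
  H.-O. Georgii (2011) Thm. 8.7, Remark 8.26.
* The tree: `RobustBall/RobustStarDoorZd.lean` (g8 Z5), `RobustBall/StarDoorZdPerturbed.lean` (locality),
  `RobustBall/StarDoorZdW.lean`, `StarFarEnergyZd.lean`, `StarFarLoadsZd.lean`, `StarTiltComparison.lean` (this seat).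
-/

noncomputable section

open MeasureTheory ProbabilityTheory Function Finset Real
open scoped NNReal
open Literature.Probability.LatticeModels
open Literature.Probability.LatticeModels.DobrushinMetric
open Literature.MathematicalPhysics.QuantumLattice hiding torusNorm
open Literature.MathematicalPhysics.QuantumFieldTheory hiding ZdEdge
open Literature.MathematicalPhysics.QuantumFieldTheory.Balaban1983to89.StrongCouplingDobrushinWindow
  (OneLinkKRModulus)
open Summit.QuantumFields.BalabanUV.InfraRed.StrongCouplingPoincareDoorSUN (OneLinkPoincareSUN)
open Summit.QuantumFields.BalabanUV.InfraRed.StrongCouplingVarianceDoorSUN (OneLinkVarianceBound)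
open Summit.Ventures.YMGap.DSWindowZd
open Summit.Ventures.YMGap.StarResolventDim (gaugeR doorPoly)

namespace Summit.Ventures.YMGap.RobustBall

variable {d N : ℕ}

/-! ### The tier-2 window contraction at one vertex -/

/-- **THE TIER-2 `ℤ^d` STAR WINDOW BOUND FOR EVERY MEMBER OF THE DIAMETER-WEIGHTED BALL.** See the module
docstring. Data: the near door data of `starWindowBoundZdR_of_memBallZdG` (one-link modulus `K` at radius
`Rm ≥ 2(d−1)|β|/N`, per-incidence coefficient `c`, cross row `lam`, in-star row `θ < 1`, `doorPoly d c < 1`, near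
received sum `ρn`), the weight `0 < κ`, a rate `0 ≤ t ≤ κ`, a box radius `D ≥ 1`, a bound `τb` of the far tilt
exponent and the closing inequality `hclose`. [folklore] -/
theorem starWindowBoundZdW_of_near {β κ ε₀ ε₁ ρn t τb ρ' : ℝ} {D D' : ℕ} (hD'eq : 2 * D + 2 ≤ D')
    (hκ : 0 < κ) (ht : 0 ≤ t) (htκ : t ≤ κ)
    (hτb : (2 * Real.sqrt N) * (((d : ℝ) + 1) * Real.exp (-(κ * D)) * ε₁) ≤ τb)
    (hclose : Real.exp τb ^ 2 * Real.exp (t * ((D' : ℝ) + 1)) * ρn +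
        (2 * Real.sqrt N) * (Real.exp τb ^ 2 + Real.exp τb ^ 4) * (((d : ℝ) + 1) * Real.exp (-(κ * D)) * ε₁) *
          (Real.exp (t * ((D' : ℝ) + 1)) * ρn) +
        2 * (2 * Real.sqrt N) * (Real.exp τb ^ 2 + Real.exp τb ^ 4) *
          (((d : ℝ) + 1) * Real.exp (2 * t) * Real.exp (-((κ - t) * D)) * ε₁) ≤ ρ')
    {W : Potential (ZdEdge d) (SUN N)} (hW : MemBallZdW κ ε₀ ε₁ W)
    (hnear : ∀ s : Site d, StarWindowBoundZdR d N
      (perturbedYM (d := d) (fundamentalRep (Fin N)) β (truncZd D s W) (truncSuppZd D s)) D' ρn suFrobDist) :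
    StarWindowBoundZdW d N (perturbedYMS (d := d) (fundamentalRep (Fin N)) β W) t ρ'
      (fun s y => ‖y.1 - s‖ + 1) suFrobDist := by
  classical
  haveI : SecondCountableTopology (Matrix (Fin N) (Fin N) ℂ) :=
    inferInstanceAs (SecondCountableTopology (Fin N → Fin N → ℂ))
  haveI : SecondCountableTopology (SUN N) := Topology.IsEmbedding.subtypeVal.secondCountableTopology
  obtain ⟨osc, lip, hosc, hlip, hoscs, hosca, hlips, hlipa⟩ := hW.loads
  obtain ⟨Bm, hBm⟩ := hW.summable
  set ρG := fundamentalRep (Fin N) with hρG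
  have hρc : Continuous ρG := continuous_fundamentalRep (Fin N)
  set Rr : ℝ := 2 * Real.sqrt N with hRr
  have hRr0 : 0 ≤ Rr := by positivity
  -- the near star arrays, one per vertex
  choose Kn hKn0 hKnsupp hKnH1 hKnH2 using hnear
  -- far constants
  set E : ℝ := Real.exp τb with hE
  set C₁ : ℝ := Rr * (E ^ 2 + E ^ 4) with hC₁
  set C₂ : ℝ := 2 * Rr * (E ^ 2 + E ^ 4) with hC₂
  have hE0 : 0 < E := Real.exp_pos _
  have hC₁0 : 0 ≤ C₁ := by positivity
  have hC₂0 : 0 ≤ C₂ := by positivity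
  set ℓ : Site d → ZdEdge d → ℝ := fun s x => ∑' X : Finset (ZdEdge d),
    (if ((X ∩ vertexStarZd s).Nonempty ∧ ¬ X ⊆ starNbhdZdR D s) ∧ x ∈ X then lip X x else 0) with hℓ
  set L : Site d → ZdEdge d → ℝ := fun s y => ∑' X : Finset (ZdEdge d),
    (if ((X ∩ vertexStarZd s).Nonempty ∧ ¬ X ⊆ starNbhdZdR D s) ∧ y ∈ X ∧ y ∉ vertexStarZd s
      then lip X y else 0) with hL
  have hℓ0 : ∀ s x, 0 ≤ ℓ s x := fun s x => tsum_nonneg fun X => by split_ifs; exacts [(hlip X).nonneg x, le_rfl]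
  have hL0 : ∀ s y, 0 ≤ L s y := fun s y => tsum_nonneg fun X => by split_ifs; exacts [(hlip X).nonneg y, le_rfl]
  have hℓs := fun s => sum_star_farLip_le (κ := κ) (ε₁ := ε₁) hlip hlips hlipa hκ.le D s
  have hLw := fun s => tsum_farExt_mul_exp_reach_le (κ := κ) (ε₁ := ε₁) hlip hlips hlipa ht htκ D s
  have hL1 := fun s => tsum_farExt_mul_exp_reach_le (κ := κ) (ε₁ := ε₁) hlip hlips hlipa le_rfl hκ.le D s
  -- the array
  set KZ : Site d → ZdEdge d → ZdEdge d → ℝ := fun s y z => if z ∈ vertexStarZd s then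
      E ^ 2 * Kn s s y z + C₁ * (∑ x ∈ vertexStarZd s, ℓ s x * Kn s s y x) + C₂ * L s y else 0 with hKZ
  have hKZ_apply : ∀ s y z, KZ s y z = if z ∈ vertexStarZd s then
      E ^ 2 * Kn s s y z + C₁ * (∑ x ∈ vertexStarZd s, ℓ s x * Kn s s y x) + C₂ * L s y else 0 :=
    fun _ _ _ => rfl
  have hKZ' : ∀ s y z, KZ s y z = if z ∈ vertexStarZd s then
      Real.exp τb ^ 2 * Kn s s y z +
        (2 * Real.sqrt ((N : ℕ) : ℝ)) * (Real.exp τb ^ 2 + Real.exp τb ^ 4) *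
          (∑ x ∈ vertexStarZd s, (∑' X : Finset (ZdEdge d),
            (if ((X ∩ vertexStarZd s).Nonempty ∧ ¬ X ⊆ starNbhdZdR D s) ∧ x ∈ X then lip X x else 0)) * Kn s s y x) +
        2 * (2 * Real.sqrt ((N : ℕ) : ℝ)) * (Real.exp τb ^ 2 + Real.exp τb ^ 4) *
          (∑' X : Finset (ZdEdge d),
            (if ((X ∩ vertexStarZd s).Nonempty ∧ ¬ X ⊆ starNbhdZdR D s) ∧ y ∈ X ∧ y ∉ vertexStarZd s then lip X y else 0))
      else 0 := by
    intro s y z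
    rw [hKZ_apply]
  refine ⟨KZ, ?_, ?_, ?_, ?_⟩
  · -- nonnegativity
    intro s y z
    rw [hKZ_apply]
    split_ifs
    · refine add_nonneg (add_nonneg (mul_nonneg (pow_nonneg hE0.le _) (hKn0 s s y z))
        (mul_nonneg hC₁0 (Finset.sum_nonneg fun x _ => mul_nonneg (hℓ0 s x) (hKn0 s s y x)))) (mul_nonneg hC₂0 (hL0 s y))
    · exact le_rfl
  · -- weighted summability
    intro s z
    by_cases hz : z ∈ vertexStarZd s
    · simp only [hKZ_apply, if_pos hz]
      have hfin : ∀ (g : ZdEdge d → ℝ), Summable fun y => Kn s s y z * g y := fun g =>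
        summable_of_ne_finset_zero (s := starNbhdZdR D' s) fun y hy => by
          rw [show Kn s s y z = 0 from by_contra fun h => hy (hKnsupp s s y z h), zero_mul]
      have hfin' : ∀ (x : ZdEdge d) (g : ZdEdge d → ℝ), Summable fun y => Kn s s y x * g y := fun x g =>
        summable_of_ne_finset_zero (s := starNbhdZdR D' s) fun y hy => by
          rw [show Kn s s y x = 0 from by_contra fun h => hy (hKnsupp s s y x h), zero_mul]
      have h3 : Summable fun y => C₂ * L s y * Real.exp (t * (‖y.1 - s‖ + 1)) := by
        have := (hLw s).1.mul_left C₂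
        refine this.congr fun y => by ring
      have h2 : Summable fun y => C₁ * (∑ x ∈ vertexStarZd s, ℓ s x * Kn s s y x) * Real.exp (t * (‖y.1 - s‖ + 1)) := by
        have : Summable fun y => ∑ x ∈ vertexStarZd s, C₁ * ℓ s x * (Kn s s y x * Real.exp (t * (‖y.1 - s‖ + 1))) :=
          summable_sum fun x _ => (hfin' x _).mul_left _
        refine this.congr fun y => ?_
        rw [Finset.mul_sum, Finset.sum_mul]
        exact Finset.sum_congr rfl fun x _ => by ring
      have h1 : Summable fun y => E ^ 2 * Kn s s y z * Real.exp (t * (‖y.1 - s‖ + 1)) := by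
        have := (hfin fun y => Real.exp (t * (‖y.1 - s‖ + 1))).mul_left (E ^ 2)
        refine this.congr fun y => by ring
      refine ((h1.add h2).add h3).congr fun y => by ring
    · simp only [hKZ_apply, if_neg hz, zero_mul]; exact summable_zero
  · -- (H1), global form: the one-centre contraction theorem
    intro c ω η f δ hfm hfB hfdep hδ0 hδ
    exact tier2_star_contraction hD'eq hW hBm hlip hlips hlipa hκ hτb hKn0 hKnsupp hKnH1 hKZ' c ω η f δ hfm
      hfB hfdep hδ0 hδ
  · -- (H2), weighted received sums
    intro s z hz
    simp only [hKZ_apply, if_pos hz]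
    have hw : ∀ y ∈ starNbhdZdR D' s, Real.exp (t * (‖y.1 - s‖ + 1)) ≤ Real.exp (t * ((D' : ℝ) + 1)) := by
      intro y hy
      exact Real.exp_le_exp.2 (mul_le_mul_of_nonneg_left (by linarith [norm_sub_le_of_mem_starNbhdZdR hy]) ht)
    have hKw : ∀ x ∈ vertexStarZd s, ∑' y, Kn s s y x * Real.exp (t * (‖y.1 - s‖ + 1)) ≤
        Real.exp (t * ((D' : ℝ) + 1)) * ρn := by
      intro x hx
      rw [tsum_eq_sum (s := starNbhdZdR D' s) fun y hy => by
        rw [show Kn s s y x = 0 from by_contra fun h' => hy (hKnsupp s s y x h'), zero_mul]]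
      calc ∑ y ∈ starNbhdZdR D' s, Kn s s y x * Real.exp (t * (‖y.1 - s‖ + 1))
          ≤ ∑ y ∈ starNbhdZdR D' s, Kn s s y x * Real.exp (t * ((D' : ℝ) + 1)) :=
            Finset.sum_le_sum fun y hy => mul_le_mul_of_nonneg_left (hw y hy) (hKn0 s s y x)
        _ = Real.exp (t * ((D' : ℝ) + 1)) * ∑ y ∈ starNbhdZdR D' s, Kn s s y x := by rw [← Finset.sum_mul, mul_comm]
        _ ≤ Real.exp (t * ((D' : ℝ) + 1)) * ρn := mul_le_mul_of_nonneg_left (hKnH2 s s x hx) (Real.exp_pos _).le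
    have hKsw : ∀ x, Summable fun y => Kn s s y x * Real.exp (t * (‖y.1 - s‖ + 1)) := fun x =>
      summable_of_ne_finset_zero (s := starNbhdZdR D' s) fun y hy => by
        rw [show Kn s s y x = 0 from by_contra fun h' => hy (hKnsupp s s y x h'), zero_mul]
    have h1 : Summable fun y => E ^ 2 * Kn s s y z * Real.exp (t * (‖y.1 - s‖ + 1)) :=
      ((hKsw z).mul_left (E ^ 2)).congr fun y => by ring
    have h2 : Summable fun y => C₁ * (∑ x ∈ vertexStarZd s, ℓ s x * Kn s s y x) * Real.exp (t * (‖y.1 - s‖ + 1)) := by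
      have : Summable fun y => ∑ x ∈ vertexStarZd s, C₁ * ℓ s x * (Kn s s y x * Real.exp (t * (‖y.1 - s‖ + 1))) :=
        summable_sum fun x _ => (hKsw x).mul_left _
      refine this.congr fun y => ?_
      rw [Finset.mul_sum, Finset.sum_mul]; exact Finset.sum_congr rfl fun x _ => by ring
    have h3 : Summable fun y => C₂ * L s y * Real.exp (t * (‖y.1 - s‖ + 1)) :=
      ((hLw s).1.mul_left C₂).congr fun y => by ring
    have hsplit3 : (fun y => (E ^ 2 * Kn s s y z + C₁ * (∑ x ∈ vertexStarZd s, ℓ s x * Kn s s y x) + C₂ * L s y) *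
        Real.exp (t * (‖y.1 - s‖ + 1))) = fun y => E ^ 2 * Kn s s y z * Real.exp (t * (‖y.1 - s‖ + 1)) +
          C₁ * (∑ x ∈ vertexStarZd s, ℓ s x * Kn s s y x) * Real.exp (t * (‖y.1 - s‖ + 1)) +
          C₂ * L s y * Real.exp (t * (‖y.1 - s‖ + 1)) := by funext y; ring
    rw [hsplit3, (h1.add h2).tsum_add h3, h1.tsum_add h2]
    have e1 : ∑' y, E ^ 2 * Kn s s y z * Real.exp (t * (‖y.1 - s‖ + 1)) ≤ E ^ 2 * (Real.exp (t * ((D' : ℝ) + 1)) * ρn) := by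
      rw [show (fun y => E ^ 2 * Kn s s y z * Real.exp (t * (‖y.1 - s‖ + 1))) =
        fun y => E ^ 2 * (Kn s s y z * Real.exp (t * (‖y.1 - s‖ + 1))) from funext fun y => by ring, tsum_mul_left]
      exact mul_le_mul_of_nonneg_left (hKw z hz) (pow_nonneg hE0.le _)
    have e2 : ∑' y, C₁ * (∑ x ∈ vertexStarZd s, ℓ s x * Kn s s y x) * Real.exp (t * (‖y.1 - s‖ + 1)) ≤
        C₁ * ((((d : ℝ) + 1) * Real.exp (-(κ * D)) * ε₁) * (Real.exp (t * ((D' : ℝ) + 1)) * ρn)) := by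
      have : ∀ y, C₁ * (∑ x ∈ vertexStarZd s, ℓ s x * Kn s s y x) * Real.exp (t * (‖y.1 - s‖ + 1)) =
          ∑ x ∈ vertexStarZd s, C₁ * ℓ s x * (Kn s s y x * Real.exp (t * (‖y.1 - s‖ + 1))) := fun y => by
        rw [Finset.mul_sum, Finset.sum_mul]; exact Finset.sum_congr rfl fun x _ => by ring
      simp_rw [this]
      rw [Summable.tsum_finsetSum (fun x _ => (hKsw x).mul_left _)]
      simp_rw [tsum_mul_left]
      calc ∑ x ∈ vertexStarZd s, C₁ * ℓ s x * ∑' y, Kn s s y x * Real.exp (t * (‖y.1 - s‖ + 1))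
          ≤ ∑ x ∈ vertexStarZd s, C₁ * ℓ s x * (Real.exp (t * ((D' : ℝ) + 1)) * ρn) :=
            Finset.sum_le_sum fun x hx => mul_le_mul_of_nonneg_left (hKw x hx) (mul_nonneg hC₁0 (hℓ0 s x))
        _ = C₁ * ((∑ x ∈ vertexStarZd s, ℓ s x) * (Real.exp (t * ((D' : ℝ) + 1)) * ρn)) := by
            rw [Finset.sum_mul, Finset.mul_sum]; exact Finset.sum_congr rfl fun x _ => by ring
        _ ≤ C₁ * ((((d : ℝ) + 1) * Real.exp (-(κ * D)) * ε₁) * (Real.exp (t * ((D' : ℝ) + 1)) * ρn)) := by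
            refine mul_le_mul_of_nonneg_left (mul_le_mul_of_nonneg_right (hℓs s).2 ?_) hC₁0
            have : 0 ≤ ρn := le_trans (Finset.sum_nonneg fun y _ => hKn0 s s y z) (hKnH2 s s z hz)
            positivity
    have e3 : ∑' y, C₂ * L s y * Real.exp (t * (‖y.1 - s‖ + 1)) ≤
        C₂ * (((d : ℝ) + 1) * Real.exp (2 * t) * Real.exp (-((κ - t) * D)) * ε₁) := by
      rw [show (fun y => C₂ * L s y * Real.exp (t * (‖y.1 - s‖ + 1))) =
        fun y => C₂ * (L s y * Real.exp (t * (‖y.1 - s‖ + 1))) from funext fun y => by ring, tsum_mul_left]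
      exact mul_le_mul_of_nonneg_left (hLw s).2 hC₂0
    refine le_trans (add_le_add (add_le_add e1 e2) e3) (le_trans (le_of_eq ?_) hclose)
    rw [hC₁, hC₂, hE, hRr]
    ring

/-! ### The doors: KR form (quarter modulus & co.) and variance form (Bakry–Émery / PV pairs) -/

/-- **THE ROBUST VERTEX-STAR DOOR ON THE TIER-2 `ℤ^d` BALL, KR FORM.** Near data = the hypotheses of
`starWindowBoundZdR_of_memBallZdG` (one-link modulus `K` at radius `Rm ≥ 2(d−1)|β|/N` for the tree coupling `β = Nβ'`,
per-incidence coefficient `c`, cross row `lam`, in-star row `θ < 1`, `doorPoly d c < 1`, near received sum `ρn`,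
locality radius `max (2D) 1 + 2`); with `0 < t ≤ κ`, the far bound `τb` and the closing inequality `hclose ≤ ρ' < 1`:
`MassGapOnBallZdW d N β' κ ε₀ ε₁` — rb-p1's tier-2 mass gap `PerturbedMassGapAtS` (unique DLR state + Shen–Zhu–Zhu
clustering at rate `t`) for EVERY member of the gauge-invariant diameter-weighted ball. [folklore] -/
theorem massGapOnBallZdW_of_robustStar (hd : 2 ≤ d) (hN : 1 ≤ N)
    {β' κ ε₀ ε₁ Rm K c lam θ ρn t τb ρ' : ℝ} {D Kn : ℕ} (hD : 1 ≤ D)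
    (hK : 0 ≤ K) (hRm : |(N : ℝ) * β'| / N * (2 * ((d : ℝ) - 1)) ≤ Rm) (hmod : OneLinkKRModulus N Rm K)
    (hε₁ : 0 ≤ ε₁)
    (hc : K * Real.exp ε₀ * (1 + 2 * Real.sqrt N * ε₁) * (|(N : ℝ) * β'| / N) ≤ c) (hlam : Real.sqrt N * ε₁ ≤ lam)
    (hθ : θ = (2 * (d : ℝ) - 2) * c + lam) (hθ1 : θ < 1) (hcd : doorPoly d c < 1)
    (hρn : ρn = gaugeR d c + (lam + θ ^ Kn * (4 * d * lam)) / (1 - θ))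
    (hκ : 0 < κ) (ht : 0 < t) (htκ : t ≤ κ)
    (hτb : (2 * Real.sqrt N) * (((d : ℝ) + 1) * Real.exp (-(κ * D)) * ε₁) ≤ τb)
    (hclose : Real.exp τb ^ 2 * Real.exp (t * ((max (2 * D) 1 + 2 : ℕ) + 1)) * ρn +
        (2 * Real.sqrt N) * (Real.exp τb ^ 2 + Real.exp τb ^ 4) * (((d : ℝ) + 1) * Real.exp (-(κ * D)) * ε₁) *
          (Real.exp (t * ((max (2 * D) 1 + 2 : ℕ) + 1)) * ρn) +
        2 * (2 * Real.sqrt N) * (Real.exp τb ^ 2 + Real.exp τb ^ 4) *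
          (((d : ℝ) + 1) * Real.exp (2 * t) * Real.exp (-((κ - t) * D)) * ε₁) ≤ ρ')
    (hρ'0 : 0 ≤ ρ') (hρ'1 : ρ' < 1) :
    MassGapOnBallZdW d N β' κ ε₀ ε₁ := by
  intro W hW
  obtain ⟨Bm, hBm⟩ := hW.summable
  have hD'eq : 2 * D + 2 ≤ max (2 * D) 1 + 2 := by omega
  have hnear : ∀ s : Site d, StarWindowBoundZdR d N
      (perturbedYM (d := d) (fundamentalRep (Fin N)) ((N : ℝ) * β') (truncZd D s W) (truncSuppZd D s))
      (max (2 * D) 1 + 2) ρn suFrobDist := fun s =>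
    starWindowBoundZdR_of_memBallZdG hd hN hK hRm hmod hε₁ hc hlam hθ hθ1 hcd hρn (hW.truncZd_mem hκ.le D s)
  have h := starWindowBoundZdW_of_near (N := N) hD'eq hκ ht.le htκ hτb (by exact_mod_cast hclose) hW hnear
  exact perturbedMassGapAtS_of_starWindowBoundZdW hBm hW.continuous hW.dependsOn ht hρ'0 hρ'1
    (reach := fun s y => ‖y.1 - s‖ + 1) (fun s y => by positivity)
    (fun s x hx y => by
      calc ‖x.1 - y.1‖ = ‖(x.1 - s) - (y.1 - s)‖ := by congr 1; abel
        _ ≤ ‖x.1 - s‖ + ‖y.1 - s‖ := norm_sub_le _ _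
        _ ≤ 1 + ‖y.1 - s‖ := by linarith [norm_sub_le_one_of_mem_vertexStarZd hx]
        _ = ‖y.1 - s‖ + 1 := by ring) h

/-- **THE ROBUST VERTEX-STAR DOOR ON THE TIER-2 `ℤ^d` BALL, VARIANCE FORM** (near data = the hypotheses of
`starWindowBoundZdR_of_memBallZdG_variance`: a Poincaré constant `cP` and a variance bound `v` at radius
`b ≥ 2(d−1)|β|/N`, `c ≥ e^{ε₀}√(cP v)|β|/N`, `lam ≥ e^{ε₀/2}√cP ε₁` — every-`N` Bakry–Émery and PV pairs). [folklore] -/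
theorem massGapOnBallZdW_of_robustStar_variance (hd : 2 ≤ d) (hN : 1 ≤ N)
    {β' κ ε₀ ε₁ b cP v c lam θ ρn t τb ρ' : ℝ} {D Kn : ℕ} (hD : 1 ≤ D)
    (hcP : 0 ≤ cP) (hv : 0 ≤ v) (hb : |(N : ℝ) * β'| / N * (2 * ((d : ℝ) - 1)) ≤ b) (hP : OneLinkPoincareSUN N b cP)
    (hVB : OneLinkVarianceBound N b v) (hε₁ : 0 ≤ ε₁)
    (hc : Real.exp ε₀ * Real.sqrt (cP * v) * (|(N : ℝ) * β'| / N) ≤ c)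
    (hlam : Real.exp (ε₀ / 2) * Real.sqrt cP * ε₁ ≤ lam)
    (hθ : θ = (2 * (d : ℝ) - 2) * c + lam) (hθ1 : θ < 1) (hcd : doorPoly d c < 1)
    (hρn : ρn = gaugeR d c + (lam + θ ^ Kn * (4 * d * lam)) / (1 - θ))
    (hκ : 0 < κ) (ht : 0 < t) (htκ : t ≤ κ)
    (hτb : (2 * Real.sqrt N) * (((d : ℝ) + 1) * Real.exp (-(κ * D)) * ε₁) ≤ τb)
    (hclose : Real.exp τb ^ 2 * Real.exp (t * ((max (2 * D) 1 + 2 : ℕ) + 1)) * ρn +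
        (2 * Real.sqrt N) * (Real.exp τb ^ 2 + Real.exp τb ^ 4) * (((d : ℝ) + 1) * Real.exp (-(κ * D)) * ε₁) *
          (Real.exp (t * ((max (2 * D) 1 + 2 : ℕ) + 1)) * ρn) +
        2 * (2 * Real.sqrt N) * (Real.exp τb ^ 2 + Real.exp τb ^ 4) *
          (((d : ℝ) + 1) * Real.exp (2 * t) * Real.exp (-((κ - t) * D)) * ε₁) ≤ ρ')
    (hρ'0 : 0 ≤ ρ') (hρ'1 : ρ' < 1) :
    MassGapOnBallZdW d N β' κ ε₀ ε₁ := by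
  intro W hW
  obtain ⟨Bm, hBm⟩ := hW.summable
  have hD'eq : 2 * D + 2 ≤ max (2 * D) 1 + 2 := by omega
  have hnear : ∀ s : Site d, StarWindowBoundZdR d N
      (perturbedYM (d := d) (fundamentalRep (Fin N)) ((N : ℝ) * β') (truncZd D s W) (truncSuppZd D s))
      (max (2 * D) 1 + 2) ρn suFrobDist := fun s =>
    starWindowBoundZdR_of_memBallZdG_variance hd hN (Kn := Kn) hcP hv hb hP hVB hε₁ hc hlam hθ hθ1 hcd hρn
      (hW.truncZd_mem hκ.le D s)
  have h := starWindowBoundZdW_of_near (N := N) hD'eq hκ ht.le htκ hτb (by exact_mod_cast hclose) hW hnear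
  exact perturbedMassGapAtS_of_starWindowBoundZdW hBm hW.continuous hW.dependsOn ht hρ'0 hρ'1
    (reach := fun s y => ‖y.1 - s‖ + 1) (fun s y => by positivity)
    (fun s x hx y => by
      calc ‖x.1 - y.1‖ = ‖(x.1 - s) - (y.1 - s)‖ := by congr 1; abel
        _ ≤ ‖x.1 - s‖ + ‖y.1 - s‖ := norm_sub_le _ _
        _ ≤ 1 + ‖y.1 - s‖ := by linarith [norm_sub_le_one_of_mem_vertexStarZd hx]
        _ = ‖y.1 - s‖ + 1 := by ring) h

end Summit.Ventures.YMGap.RobustBall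

end
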